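import Summits.BirchSwinnertonDyer.Rank1Residual.X2.RouteGThreeTorsionModL
import Mathlib.Tactic.NormNum.LegendreSymbol
import HarnessLib

/-!
# Route G at `p = 3`: `3 ∤ #Ẽ(𝔽_ℓ)` at a LARGE good prime `ℓ` WITHOUT a point count — the complementary certificate
# (cell `bsd-eis`, seat `bsd-eis-k5-c3` g4; THEOREMS ONLY, nothing booked)

HONEST FRAMING (FULL-BSD rank-≤1 programme D-0033, cell `bsd-eis`; row A10). A route-G display evaluates
Greenberg–Vatsal's local invariant `δ_ℓ = s_ℓ · d_ℓ` of BOTH curves of a `3`-congruent pair at every place of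
`S₀` (`X2/LocalDeltaCalculus.lean`). At a GOOD place `ℓ` of one curve, `d_ℓ = 0 ↔ 3 ∤ ℓ + 1 − a_ℓ = #Ẽ(𝔽_ℓ)`
(`dMultiplicity_eq_zero_iff_of_hasGoodReductionAt`). So far `3 ∣ #Ẽ(𝔽_ℓ)` had two count-free certificates (a rational
point of order `3`, `X2/RouteGThreeTorsionCount.lean`; an explicit `𝔽_ℓ`-point of order `3`, `X2/RouteGThreeTorsionModL.lean`)
but `3 ∤ #Ẽ(𝔽_ℓ)` had NONE: it was decided by a kernel point count, feasible for `ℓ ≲ 1500` only — which excludes every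
pencil relative outside Cremona's table with a large "cross" prime at which the other curve has no point of order `3`
(k5-c3 g2 HANDOFF: "the complementary certificate is NOT built"). This file builds it:
* `not_three_dvd_natCard_point_of_eval_Ψ₃_ne_zero` — over a finite field: if NO affine point `(x, y)` of `V` has
  `Ψ₃(x) = 0`, then `V(F)` has no element of order `3` (a point of order `3` is not `2`-torsion, so `Ψ₃(x) = 0` by the
  tree's `three_smul_some_eq_zero_iff`), hence `3 ∤ #V(F)` (Cauchy);
* `eval_Ψ₃_ne_zero_of_four_bad_roots` — the CERTIFICATE SHAPE: four distinct roots `r₁..r₄ ∈ 𝔽_ℓ` of `Ψ₃` (then they are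
  ALL its roots: `deg Ψ₃ = 4`) none of which is the `x`-coordinate of an `𝔽_ℓ`-point;
* `not_equation_of_legendreSym` — "`r` is not an `x`-coordinate" from ONE Legendre symbol: the `y`-discriminant
  `(a₁r + a₃)² + 4(r³ + a₂r² + a₄r + a₆)` is a non-residue mod `ℓ` (`norm_num`'s Jacobi extension evaluates it);
* `not_three_dvd_natGenerator_add_one_sub_frobeniusTraceAt_of_noModPoint` — the display form: for a globally minimal
  `W/ℚ` with integer model `E₀` and a good prime `ℓ`, the hypothesis of the `δ_ℓ = 0` branch
  (`(dMultiplicity_eq_zero_iff_of_hasGoodReductionAt _ _).mpr`) WITHOUT a point count.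
WHEN IT APPLIES (our targets have reducible `E[3]` with a Galois-stable line `χ`): at a good `ℓ ≡ 1 (mod 3)` with
`χ(ℓ) = −1` the Frobenius has both eigenvalues `−1` on `E[3]`; when it is moreover semisimple (`= −1`), all four roots
of `Ψ₃` lie in `𝔽_ℓ` and none lifts — exactly the certificate shape above. (The non-semisimple case, `Ψ₃ ≡` linear ×
irreducible cubic, is NOT covered here.)
References: [SilvermanAEC2009] III Ex. 3.7; [GreenbergVatsal2000] §2 Prop. (2.4), p. 27.
-/

set_option autoImplicit false

noncomputable section

open scoped Classical

open WeierstrassCurve NumberField IsDedekindDomain Polynomial Literature.NumberTheory.EllipticCurves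
  Summit.BirchSwinnertonDyer.BirchSwinnertonDyer.Rank1Residual.IntModel

namespace Summit.BirchSwinnertonDyer.Rank1Residual.X2.RouteGThreeTorsion

/-- **No affine point with `Ψ₃(x) = 0` ⇒ `3 ∤ #V(F)`** over a finite field: an element of order `3` (Cauchy) would be
an affine point `P = (x, y)`; it is not `2`-torsion (else its order divides `2`), so `y ≠ −y − a₁x − a₃` and the tree's
`three_smul_some_eq_zero_iff` gives `Ψ₃(x) = 0`. [cite: SilvermanAEC2009, III Ex. 3.7] -/
theorem not_three_dvd_natCard_point_of_eval_Ψ₃_ne_zero {F : Type*} [Field F] [Finite F] [DecidableEq F]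
    (V : WeierstrassCurve F) (h : ∀ x y : F, V.toAffine.Nonsingular x y → V.Ψ₃.eval x ≠ 0) :
    ¬ 3 ∣ Nat.card V.toAffine.Point := by
  haveI := BinaryQuartic.finite_point V
  letI : Fintype V.toAffine.Point := Fintype.ofFinite _
  haveI : Fact (Nat.Prime 3) := ⟨Nat.prime_three⟩
  intro hdvd
  rw [Nat.card_eq_fintype_card] at hdvd
  obtain ⟨P, hP⟩ := exists_prime_addOrderOf_dvd_card 3 hdvd
  cases P with
  | zero =>
    rw [← Affine.Point.zero_def, addOrderOf_zero] at hP
    exact absurd hP (by norm_num)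
  | @some x y hns =>
    have h3 : (3 : ℕ) • (Affine.Point.some x y hns : V.toAffine.Point) = 0 := hP ▸ addOrderOf_nsmul_eq_zero _
    by_cases hy : y = V.toAffine.negY x y
    · -- `P = −P`, so `2 • P = 0` and the order `3` would divide `2`
      have hneg : -(Affine.Point.some x y hns : V.toAffine.Point) = Affine.Point.some x y hns := by
        rw [Affine.Point.neg_some, Affine.Point.some.injEq]
        exact ⟨rfl, hy.symm⟩
      have h2 : (2 : ℕ) • (Affine.Point.some x y hns : V.toAffine.Point) = 0 := by
        rw [two_nsmul]
        nth_rewrite 2 [← hneg]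
        exact add_neg_cancel _
      have h32 : 3 ∣ 2 := hP ▸ addOrderOf_dvd_of_nsmul_eq_zero h2
      omega
    · have h3z : (3 : ℤ) • (Affine.Point.some x y hns : V.toAffine.Point) = 0 := by exact_mod_cast h3
      have hψ := (WeierstrassCurve.three_smul_some_eq_zero_iff (V := V) hns hy).mp h3z
      rw [ψ_three, evalEval_C] at hψ
      exact h x y hns hψ

/-- **The certificate shape: four distinct roots of `Ψ₃` in `F`, none of them an `x`-coordinate of an `F`-point,
leave NO affine point with `Ψ₃(x) = 0`** (`Ψ₃` has degree `4` when `3 ≠ 0` in `F`, so a fifth root is impossible).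
[cite: SilvermanAEC2009, III Ex. 3.7] -/
theorem eval_Ψ₃_ne_zero_of_four_bad_roots {F : Type*} [Field F] [DecidableEq F] (V : WeierstrassCurve F)
    (h3 : (3 : F) ≠ 0) (T : Finset F) (hT : T.card = 4) (hroot : ∀ r ∈ T, V.Ψ₃.eval r = 0)
    (hno : ∀ r ∈ T, ∀ y : F, ¬ V.toAffine.Equation r y) :
    ∀ x y : F, V.toAffine.Nonsingular x y → V.Ψ₃.eval x ≠ 0 := by
  intro x y hns hx
  by_cases hxT : x ∈ T
  · exact hno x hxT y hns.left
  · have hdeg : V.Ψ₃.natDegree = 4 := V.natDegree_Ψ₃ h3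
    have hne : V.Ψ₃ ≠ 0 := by
      intro h0
      rw [h0, natDegree_zero] at hdeg
      exact absurd hdeg (by norm_num)
    have hsub : insert x T ⊆ V.Ψ₃.roots.toFinset := by
      intro r hr
      rw [Multiset.mem_toFinset, mem_roots hne, IsRoot.def]
      rcases Finset.mem_insert.mp hr with rfl | hr
      · exact hx
      · exact hroot r hr
    have h5 : (insert x T).card = 5 := by rw [Finset.card_insert_of_notMem hxT, hT]
    have hle := (Finset.card_le_card hsub).trans
      ((Multiset.toFinset_card_le _).trans ((card_roots' V.Ψ₃).trans V.natDegree_Ψ₃_le))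
    omega

/-- **`r` is not the `x`-coordinate of an `𝔽_ℓ`-point of the integer model `E₀ mod ℓ`, from ONE Legendre symbol**:
on `y² + a₁ r y + a₃ y = r³ + a₂ r² + a₄ r + a₆` the quantity `(2y + a₁r + a₃)²` equals the `y`-discriminant
`d = (a₁r + a₃)² + 4(r³ + a₂r² + a₄r + a₆)`; if `d` is a quadratic non-residue mod `ℓ` there is no such `y`.
[cite: SilvermanAEC2009, III §1] -/
theorem not_equation_of_legendreSym (E₀ : WeierstrassCurve ℤ) (ℓ : ℕ) [Fact ℓ.Prime] (r : ℤ)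
    (hleg : legendreSym ℓ ((E₀.a₁ * r + E₀.a₃) ^ 2 + 4 * (r ^ 3 + E₀.a₂ * r ^ 2 + E₀.a₄ * r + E₀.a₆)) = -1) :
    ∀ y : ZMod ℓ, ¬ (E₀.map (Int.castRingHom (ZMod ℓ))).toAffine.Equation (r : ZMod ℓ) y := by
  intro y hy
  rw [WeierstrassCurve.Affine.equation_iff] at hy
  simp only [WeierstrassCurve.map, eq_intCast] at hy
  have hsq : IsSquare ((((E₀.a₁ * r + E₀.a₃) ^ 2 + 4 * (r ^ 3 + E₀.a₂ * r ^ 2 + E₀.a₄ * r + E₀.a₆) : ℤ) :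
      ZMod ℓ)) := by
    refine ⟨2 * y + (E₀.a₁ : ZMod ℓ) * (r : ZMod ℓ) + (E₀.a₃ : ZMod ℓ), ?_⟩
    push_cast
    linear_combination (-4 : ZMod ℓ) * hy
  exact (legendreSym.eq_neg_one_iff ℓ).mp hleg hsq

/-- **`3 ∤ ℓ + 1 − a_ℓ = #Ẽ(𝔽_ℓ)` at the place of a good prime `ℓ` WITHOUT a point count** (globally minimal `W` with
integer model `E₀`, `a_ℓ(W) = ℓ + 1 − #(E₀ mod ℓ)(𝔽_ℓ)` = the tree's `frobeniusTrace_eq`): if no affine point of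
`E₀ mod ℓ` has `Ψ₃(x) = 0` (e.g. by `eval_Ψ₃_ne_zero_of_four_bad_roots` + `not_equation_of_legendreSym`), then the
hypothesis of the `δ_ℓ = 0` branch `(dMultiplicity_eq_zero_iff_of_hasGoodReductionAt _ _).mpr` holds at `p = 3`.
[cite: SilvermanAEC2009, III Ex. 3.7] [cite: GreenbergVatsal2000, §2 Prop. (2.4), p. 27] -/
theorem not_three_dvd_natGenerator_add_one_sub_frobeniusTraceAt_of_noModPoint (W : WeierstrassCurve ℚ)
    [W.IsElliptic] [W.IsGloballyMinimal] {E₀ : WeierstrassCurve ℤ} (hI : integralModelInt W = E₀) (ℓ : ℕ)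
    (hℓ : ℓ.Prime)
    (h : ∀ x y : ZMod ℓ, (E₀.map (Int.castRingHom (ZMod ℓ))).toAffine.Nonsingular x y →
      (E₀.map (Int.castRingHom (ZMod ℓ))).Ψ₃.eval x ≠ 0) :
    ¬ ((3 : ℕ) : ℤ) ∣ (Rat.HeightOneSpectrum.natGenerator
        ((Rat.HeightOneSpectrum.primesEquiv (R := 𝓞 ℚ)).symm ⟨ℓ, hℓ⟩) + 1 -
      W.frobeniusTraceAt ((Rat.HeightOneSpectrum.primesEquiv (R := 𝓞 ℚ)).symm ⟨ℓ, hℓ⟩) : ℤ) := by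
  haveI : Fact ℓ.Prime := ⟨hℓ⟩
  have hndvd : ¬ 3 ∣ Nat.card ((E₀.map (Int.castRingHom (ZMod ℓ))).toAffine.Point) :=
    not_three_dvd_natCard_point_of_eval_Ψ₃_ne_zero _ h
  have hgen : Rat.HeightOneSpectrum.natGenerator
      ((Rat.HeightOneSpectrum.primesEquiv (R := 𝓞 ℚ)).symm ⟨ℓ, hℓ⟩) = ℓ :=
    congrArg Subtype.val (Equiv.apply_symm_apply (Rat.HeightOneSpectrum.primesEquiv (R := 𝓞 ℚ)) _)
  have hev : Rat.HeightOneSpectrum.primesEquiv (R := 𝓞 ℚ)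
      ((Rat.HeightOneSpectrum.primesEquiv (R := 𝓞 ℚ)).symm ⟨ℓ, hℓ⟩) = ⟨ℓ, hℓ⟩ := Equiv.apply_symm_apply _ _
  rw [hgen, WeierstrassCurve.frobeniusTraceAt_eq_frobeniusTrace, hev]
  show ¬ ((3 : ℕ) : ℤ) ∣ (ℓ : ℤ) + 1 - W.frobeniusTrace ℓ
  rw [frobeniusTrace_eq hI rfl]
  rw [show (ℓ : ℤ) + 1 - ((ℓ : ℤ) + 1 - (Nat.card ((E₀.map (Int.castRingHom (ZMod ℓ))).toAffine.Point) : ℤ)) =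
      (Nat.card ((E₀.map (Int.castRingHom (ZMod ℓ))).toAffine.Point) : ℤ) by ring]
  exact_mod_cast hndvd

end Summit.BirchSwinnertonDyer.Rank1Residual.X2.RouteGThreeTorsion

end
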